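import Summits.QuantumFields.BalabanUV.Beta.EriceRemainderEnclosureHistoryAutonomyComparisonAgeCompositionLightLoad
import Summits.QuantumFields.BalabanUV.Beta.EriceRemainderEnclosureHistoryAutonomyComparisonAgeCompositionRowCertificate

/-!
# EriceRemainderEnclosureHistoryAutonomyComparisonAgeCompositionNextRow — (E113b) route (N), first order: THE END BEYOND MASS ONE FOR EVERY PROFILE — THE
# NEXT-ROW CERTIFICATE ALONG THE FLOW.  For ANY profile `L ≥ 0`, ANY damping in `]0,1]`, ANY horizon: if at every pin `m` some `θ_m ≥ 0` makes
#     `θ_m + (KA 1 m 0 − θ_m)₊ + Σ_{1 ≤ l < K} (KA 1 m l − θ_m·KA 1 (m+1) (l−1))₊ ≤ 1`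
# (`KA 1 m l` = the aggregate damped kernel of (E80b)∕(E86i): row `m` reads the surplus at depth `m+1+l`), THEN the comparison surplus of every admissible
# excess satisfies `0 ≤ ε ≤ e` (**`flow_nonneg_of_next_row_certificate`**; (E113a) `sol_nonneg_le_of_next_row` along the flow).  `θ ≡ 0` IS the light-load
# END (E86i) (`Σ_l KA 1 m l ≤ 1`); `θ_m = KA 1 m 0` (the top entry, **`flow_nonneg_of_next_row_top`**) and `θ ≡ 1` (**`flow_nonneg_of_row_shift`**: every row
# dominated ENTRYWISE by the shifted next row and top entry `≤ 1` — NO condition on the row masses) are the two instances the census uses.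
# WHY THIS IS THE SUCCESSOR OF THE MASS ROUTE (README `HOME/b2b-balaban-beta-d4-p2/g94/README.md` §2–§4): the total window load `T(m) = Σ_l KA 1 m l`
# (undamped) is NOT `≤ 1` along all admissible flows — at the infrared pin its supremum tends to `(1+√2)∕2` ((E113c): an explicit two-age witness with
# `T(0) ≥ 1.08`, kernel-checked) — so (E86i)∕(E89b)∕(E112a) cannot reach every profile; but on that witness the next-row certificate has mass `0.80`
# (`θ_0` = the top entry `0.63`): the OLD entries of row `m` are those of row `m+1` up to the factor `(a_{m+k}∕a_{m+k+1})^{3∕2}·g ≈ 1`, the YOUNG entry IS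
# the top entry, and `T(m) ≤ 1` from the first interior pin on.  Numerically (kit job of README §5) the certificate mass stays `≤ 0.8x` on every
# configuration of the census of generations 77–93 AND on the new `T > 1` region.

Cell `pub-balaban`, β-function sub-cell, BINDER row D4 «RemainderConst leaves for Bałaban's split» (`HOME/BINDER-OWNERS.md`; owner lineage `b2b-balaban-beta-an4`;
this file by co-owner #2 lineage `b2b-balaban-beta-d4-p2`, generation 94), β-FLOW TEAM duty (1), FREEZE (0) honoured (def-free; imports (E86i), (E113a); uses
(E113a) `sol_nonneg_le_of_next_row`, (E80a) `weight_nonneg`, (E80b) `aggregate_eq_sum`, (E86a) `sum_range_of_le`∕`aggregate_eq_zero_of_horizon` BY NAME;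
the display of `KL`, `KA`, `RA` is (E86i)'s VERBATIM; nothing restated).

HONEST FRAMING (page 1, verbatim and binding).  *"Discharging BetaPertH makes Bałaban's UV stability UNCONDITIONAL — a real constructive-QFT result; it is
NOT the continuum limit and NOT the Clay problem."*  THIS FILE DISCHARGES NOTHING OF THE KIND.  Elementary real analysis about ABSTRACT functionals on a box
]0,γ]^ℕ with displayed floors, profiles and signs, and the FIRST-ORDER renewal objects of route (N) built from them — hypotheses of a census, not facts; the
form, signs, ages and moments of Bałaban's (1.22) limit functional are NOT PRINTED ([I] p. 298; GAPS G-t4-U2-1∕-2) and NOT asserted.  Row D4 class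
UNCHANGED (critical-path width 0; instance 0∕1; D4 DISCHARGE NO DATE).  HONEST DEPENDENCY: continuum YM on T⁴ ⇐ BetaPertH ∧ nine spine estimates (0/9
proved); BetaPertH ⇐ (D1) ∧ (D4) ∧ CAP+tail; G-an2-4 gates asym, D1 and NE2/3/4.

NOT CLAIMED: that the certificate exists along every admissible flow for every profile (README §6: OPEN — it is implied by two displayed inequalities between
the row mass `T(m)`, the top entry `F(m)` and the next row; both hold with margin on the whole numerical census); anything printed — NOT B12 Thm 2, NOT
BetaPertH.

WHAT IS PROVED ([folklore]; 0 `def`, 0 sorry).  **`flow_nonneg_of_next_row_certificate`**, `flow_nonneg_of_next_row_top`, `flow_nonneg_of_row_shift`.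
-/
noncomputable section
open Finset

namespace Summit.QuantumFields.BalabanUV.Beta.EriceRemainderEnclosureHistoryAutonomyComparisonAgeCompositionNextRow

open Literature.MathematicalPhysics.QuantumFieldTheory.Balaban1983to89
open Literature.MathematicalPhysics.QuantumFieldTheory.Balaban1983to89.T4BetaStationary
open Summit.QuantumFields.BalabanUV.Beta.EriceRemainderEnclosureHistoryAutonomyComparisonAgeCompositionRowCertificate (sol_nonneg_le_of_next_row)
open Summit.QuantumFields.BalabanUV.Beta.EriceRemainderEnclosureHistoryAutonomyComparisonAgeCompositionIdentification (weight_nonneg)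
open Summit.QuantumFields.BalabanUV.Beta.EriceRemainderEnclosureHistoryAutonomyComparisonAgeCompositionChainWiring (aggregate_eq_sum)
open Summit.QuantumFields.BalabanUV.Beta.EriceRemainderEnclosureHistoryAutonomyComparisonAgeCompositionDecayHorizon (sum_range_of_le aggregate_eq_zero_of_horizon)

variable {γ : ℝ} {L : ℕ → ℝ} {K : ℕ} {h g : ℕ → ℝ} {KL : ℕ → ℕ → ℕ → ℝ}

/-- **ROUTE (N), FIRST ORDER — THE END BY THE NEXT-ROW CERTIFICATE (ANY PROFILE, ANY DAMPING, ANY HORIZON).**  `L ≥ 0` on the ages `< K` (`K ≥ 1`), `h` a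
box history, `g` a damping with `0 < g ≤ 1`, the lone kernels `KL` and their aggregates `KA` as displayed ((E86i) verbatim), horizon `N ≥ K`.  IF at every
pin `m` a number `θ m ≥ 0` satisfies `θ m + Σ_{l<K} (KA 1 m l − θ m·E m l)₊ ≤ 1` with `E m 0 = 1`, `E m l = KA 1 (m+1) (l−1)` (the next equation seen from
`m`), THEN the comparison surplus `ε` of every admissible excess `e` (`e ≥ 0` non-increasing) satisfies `0 ≤ ε m ≤ e m` at every pin. [folklore] -/
theorem flow_nonneg_of_next_row_certificate (hL : ∀ k, 0 ≤ L k) (hh : SeqBox γ h) (hg : ∀ t, 0 < g t ∧ g t ≤ 1) (hK : 1 ≤ K) {N : ℕ} (hKN : K ≤ N)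
    (hKL : ∀ k n l, KL k n l = if 0 < k ∧ k < K ∧ l < k then L k * h (n + k) ^ 3 / 2 * ∏ t ∈ Ico (n + 1 + l) (n + k + 1), g t else 0)
    {KA : ℕ → ℕ → ℕ → ℝ} {RA : ℕ → (ℕ → ℝ) → ℕ → ℝ}
    (hRA : ∀ i v m, RA i v m = ∑ l ∈ range K, KA i m l * v (m + 1 + l))
    (hKA : ∀ i m l, KA i m l = KL i m l + KA (i + 1) m l) (hKAtop : ∀ m l, KA K m l = 0)
    {θ : ℕ → ℝ} (hθ : ∀ m, 0 ≤ θ m)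
    (hnext : ∀ m, θ m + ∑ l ∈ range K, max 0 (KA 1 m l - θ m * (if l = 0 then 1 else KA 1 (m + 1) (l - 1))) ≤ 1)
    {e ε : ℕ → ℝ} (he0 : ∀ m, 0 ≤ e m) (hea : ∀ m, e (m + 1) ≤ e m)
    (hεt : ∀ m, N < m → ε m = 0) (hεrec : ∀ m, ε m = e m - RA 1 ε m) : ∀ m, 0 ≤ ε m ∧ ε m ≤ e m := by
  have hh0 : ∀ n, 0 < h n := fun n => (hh n).1
  have hKL0 := weight_nonneg hL hh0 hg hKL
  have hKLK : ∀ i m l, K ≤ l + 1 → KL i m l = 0 := fun i m l hl => by rw [hKL, if_neg (by omega)]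
  have hKLtop : ∀ i m l, K ≤ i → KL i m l = 0 := fun i m l hi => by rw [hKL, if_neg (by omega)]
  have hKA0 : ∀ i m l, K ≤ l → KA i m l = 0 :=
    aggregate_eq_zero_of_horizon hKA hKAtop (fun i m l hl => hKLK i m l (by omega)) hKLtop
  have hKA1 : ∀ m l, KA 1 m l = ∑ k ∈ Ico 1 (K - 1 + 1), KL k m l := fun m l =>
    aggregate_eq_sum (n := K - 1) hKA (fun m l => by rw [Nat.sub_add_cancel hK]; exact hKAtop m l) (show 1 ≤ K - 1 + 1 by omega) m l
  have hKA10 : ∀ m l, 0 ≤ KA 1 m l := fun m l => by rw [hKA1]; exact sum_nonneg fun k _ => hKL0 k m l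
  have hRA' : ∀ v m, RA 1 v m = ∑ l ∈ range N, KA 1 m l * v (m + 1 + l) := fun v m => by
    rw [hRA]; exact sum_range_of_le hKN fun l hl => by rw [hKA0 1 m l hl, zero_mul]
  -- the certificate over `range N`: the entries beyond `K` vanish and their deficits are `0`
  have hcert : ∀ m, θ m + ∑ l ∈ range N, max 0 (KA 1 m l - θ m * (if l = 0 then 1 else KA 1 (m + 1) (l - 1))) ≤ 1 := fun m => by
    rw [← sum_range_of_le hKN fun l hl => ?_]
    · exact hnext m
    · rw [hKA0 1 m l hl, if_neg (by omega), max_eq_left]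
      have := mul_nonneg (hθ m) (hKA10 (m + 1) (l - 1)); linarith
  exact sol_nonneg_le_of_next_row (K := KA 1) (R := RA 1) hRA' hKA10 hθ hcert he0 hea hεt hεrec

/-- `θ m` = THE TOP ENTRY `KA 1 m 0` (the damped lag-zero mass `Σ_k L_kh(m+k)³∕2·Π g`, `≤ √2∕2` at the infrared pin and `≤ ½` deeper along admissible
flows): `KA 1 m 0 + Σ_{1≤l<K} (KA 1 m l − KA 1 m 0·KA 1 (m+1) (l−1))₊ ≤ 1` at every pin ⟹ `0 ≤ ε ≤ e`. [folklore] -/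
theorem flow_nonneg_of_next_row_top (hL : ∀ k, 0 ≤ L k) (hh : SeqBox γ h) (hg : ∀ t, 0 < g t ∧ g t ≤ 1) (hK : 1 ≤ K) {N : ℕ} (hKN : K ≤ N)
    (hKL : ∀ k n l, KL k n l = if 0 < k ∧ k < K ∧ l < k then L k * h (n + k) ^ 3 / 2 * ∏ t ∈ Ico (n + 1 + l) (n + k + 1), g t else 0)
    {KA : ℕ → ℕ → ℕ → ℝ} {RA : ℕ → (ℕ → ℝ) → ℕ → ℝ}
    (hRA : ∀ i v m, RA i v m = ∑ l ∈ range K, KA i m l * v (m + 1 + l))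
    (hKA : ∀ i m l, KA i m l = KL i m l + KA (i + 1) m l) (hKAtop : ∀ m l, KA K m l = 0)
    (hnext : ∀ m, KA 1 m 0 + ∑ l ∈ range K, (if l = 0 then 0 else max 0 (KA 1 m l - KA 1 m 0 * KA 1 (m + 1) (l - 1))) ≤ 1)
    {e ε : ℕ → ℝ} (he0 : ∀ m, 0 ≤ e m) (hea : ∀ m, e (m + 1) ≤ e m)
    (hεt : ∀ m, N < m → ε m = 0) (hεrec : ∀ m, ε m = e m - RA 1 ε m) : ∀ m, 0 ≤ ε m ∧ ε m ≤ e m := by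
  have hh0 : ∀ n, 0 < h n := fun n => (hh n).1
  have hKL0 := weight_nonneg hL hh0 hg hKL
  have hKA1 : ∀ m l, KA 1 m l = ∑ k ∈ Ico 1 (K - 1 + 1), KL k m l := fun m l =>
    aggregate_eq_sum (n := K - 1) hKA (fun m l => by rw [Nat.sub_add_cancel hK]; exact hKAtop m l) (show 1 ≤ K - 1 + 1 by omega) m l
  have hKA10 : ∀ m l, 0 ≤ KA 1 m l := fun m l => by rw [hKA1]; exact sum_nonneg fun k _ => hKL0 k m l
  refine flow_nonneg_of_next_row_certificate hL hh hg hK hKN hKL hRA hKA hKAtop (θ := fun m => KA 1 m 0) (fun m => hKA10 m 0) (fun m => ?_)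
    he0 hea hεt hεrec
  calc KA 1 m 0 + ∑ l ∈ range K, max 0 (KA 1 m l - KA 1 m 0 * (if l = 0 then 1 else KA 1 (m + 1) (l - 1)))
      = KA 1 m 0 + ∑ l ∈ range K, (if l = 0 then 0 else max 0 (KA 1 m l - KA 1 m 0 * KA 1 (m + 1) (l - 1))) := by
        refine congrArg (KA 1 m 0 + ·) (sum_congr rfl fun l _ => ?_)
        split_ifs with hl
        · subst hl; simp
        · rfl
    _ ≤ 1 := hnext m

/-- `θ ≡ 1`: **ROWS DOMINATED BY THE SHIFTED NEXT ROW.**  If at every pin the top entry is `≤ 1` and `KA 1 m l ≤ KA 1 (m+1) (l−1)` for `1 ≤ l < K` (each row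
of the aggregate damped kernel is entrywise below the next row shifted by one lag), then `0 ≤ ε ≤ e` — NO condition on the row masses `T(m)`. [folklore] -/
theorem flow_nonneg_of_row_shift (hL : ∀ k, 0 ≤ L k) (hh : SeqBox γ h) (hg : ∀ t, 0 < g t ∧ g t ≤ 1) (hK : 1 ≤ K) {N : ℕ} (hKN : K ≤ N)
    (hKL : ∀ k n l, KL k n l = if 0 < k ∧ k < K ∧ l < k then L k * h (n + k) ^ 3 / 2 * ∏ t ∈ Ico (n + 1 + l) (n + k + 1), g t else 0)
    {KA : ℕ → ℕ → ℕ → ℝ} {RA : ℕ → (ℕ → ℝ) → ℕ → ℝ}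
    (hRA : ∀ i v m, RA i v m = ∑ l ∈ range K, KA i m l * v (m + 1 + l))
    (hKA : ∀ i m l, KA i m l = KL i m l + KA (i + 1) m l) (hKAtop : ∀ m l, KA K m l = 0)
    (htop : ∀ m, KA 1 m 0 ≤ 1) (hshift : ∀ m l, 1 ≤ l → l < K → KA 1 m l ≤ KA 1 (m + 1) (l - 1))
    {e ε : ℕ → ℝ} (he0 : ∀ m, 0 ≤ e m) (hea : ∀ m, e (m + 1) ≤ e m)
    (hεt : ∀ m, N < m → ε m = 0) (hεrec : ∀ m, ε m = e m - RA 1 ε m) : ∀ m, 0 ≤ ε m ∧ ε m ≤ e m := by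
  refine flow_nonneg_of_next_row_certificate hL hh hg hK hKN hKL hRA hKA hKAtop (θ := fun _ => 1) (fun _ => zero_le_one) (fun m => ?_)
    he0 hea hεt hεrec
  rw [sum_eq_zero fun l hl => ?_]
  · norm_num
  · rw [max_eq_left_iff, one_mul, sub_nonpos]
    split_ifs with h0
    · subst h0; exact htop m
    · exact hshift m l (by omega) (mem_range.mp hl)

end Summit.QuantumFields.BalabanUV.Beta.EriceRemainderEnclosureHistoryAutonomyComparisonAgeCompositionNextRow

end
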